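import Mathlib.Probability.Distributions.Gaussian.HasGaussianLaw.Independence
import Mathlib.Probability.Independence.Integration
import Mathlib.Analysis.SpecialFunctions.Gaussian.GaussianIntegral
import Mathlib.MeasureTheory.Group.Integral
import HarnessLib

/-!
# Gaussian expectations of exponentials of negative quadratic forms (topic `Probability/Distributions`)

Two classical closed forms:

* `integral_exp_neg_mul_add_sq_gaussianReal` — for the real Gaussian `𝒩(0, v)` (Mathlib's
  `ProbabilityTheory.gaussianReal 0 v`), `c ≥ 0` and `m ∈ ℝ`,
  `∫ exp(-c (m + x)²/2) 𝒩(0,v)(dx) = exp(-c m² / (2(1 + c v))) / √(1 + c v)`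
  (complete the square and use `∫ e^{-b x²} dx = √(π/b)`, Mathlib's `integral_gaussian`);
* `integral_exp_neg_quadratic_of_hasGaussianLaw` — for a centred jointly Gaussian pair `(X, Y)`
  (Mathlib's `ProbabilityTheory.HasGaussianLaw (fun ω ↦ (X ω, Y ω)) P`) with `Var X = a`,
  `Var Y = b`, `Cov(X, Y) = c` and `k, l ≥ 0`,
  `E exp(-(k X² + l Y²)/2) = ((1 + k a)(1 + l b) - k l c²)^{-1/2}`,
  i.e. `det(I + Σ D)^{-1/2}` for `Σ` the covariance matrix and `D = diag(k, l)`; proved by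
  decorrelation (`Y = (c/a) X + W` with `W` Gaussian and independent of `X`, Mathlib's
  `HasGaussianLaw.indepFun_of_covariance_eq_zero`) and two applications of the first formula.

These are the Gaussian inputs of Varadhan's second-moment computation for the mollified
self-intersection local time of planar Brownian motion
(`Literature.Barriers.CriticalPhenomena.Edwards2D.Varadhan1969_renormalisation`).

## References

* S. Janson, *Gaussian Hilbert Spaces*, Cambridge Tracts in Math. 129 (1997), Ch. 1 (Gaussian
  integrals of exponentials of quadratic forms). [folklore]
-/

namespace Literature.Probability.Distributions

open MeasureTheory ProbabilityTheory Real
open scoped NNReal ENNReal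

/-- **Gaussian integral of `exp(-c(m+x)²/2)`**: for `c ≥ 0`,
`∫ exp(-c (m + x)²/2) 𝒩(0,v)(dx) = exp(-c m²/(2(1 + c v))) / √(1 + c v)` (complete the square;
for `v = 0` both sides are `exp(-c m²/2)`). [folklore] -/
theorem integral_exp_neg_mul_add_sq_gaussianReal (v : ℝ≥0) {c : ℝ} (hc : 0 ≤ c) (m : ℝ) :
    ∫ x, rexp (-(c * (m + x) ^ 2) / 2) ∂gaussianReal 0 v =
      rexp (-(c * m ^ 2) / (2 * (1 + c * v))) / √(1 + c * v) := by
  by_cases hv : v = 0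
  · subst hv
    simp
  have hvpos : 0 < (v : ℝ) := NNReal.coe_pos.2 (pos_iff_ne_zero.2 hv)
  have hApos : 0 < 1 + c * v := by positivity
  rw [integral_gaussianReal_eq_integral_smul hv]
  have hpt : ∀ x : ℝ, gaussianPDFReal 0 v x • rexp (-(c * (m + x) ^ 2) / 2) =
      ((√(2 * π * v))⁻¹ * rexp (-(c * m ^ 2) / (2 * (1 + c * v)))) *
        rexp (-((1 + c * v) / v / 2) * (x + c * m * v / (1 + c * v)) ^ 2) := by
    intro x
    simp only [gaussianPDFReal, smul_eq_mul, sub_zero]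
    have hexp : rexp (-x ^ 2 / (2 * (v : ℝ))) * rexp (-(c * (m + x) ^ 2) / 2) =
        rexp (-(c * m ^ 2) / (2 * (1 + c * v))) *
          rexp (-((1 + c * v) / v / 2) * (x + c * m * v / (1 + c * v)) ^ 2) := by
      rw [← Real.exp_add, ← Real.exp_add]
      congr 1
      field_simp
      ring
    calc (√(2 * π * (v : ℝ)))⁻¹ * rexp (-x ^ 2 / (2 * (v : ℝ))) * rexp (-(c * (m + x) ^ 2) / 2)
        = (√(2 * π * (v : ℝ)))⁻¹ * (rexp (-x ^ 2 / (2 * (v : ℝ))) * rexp (-(c * (m + x) ^ 2) / 2)) := by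
          ring
      _ = _ := by rw [hexp]; ring
  simp_rw [hpt]
  rw [integral_const_mul,
    integral_add_right_eq_self (fun y => rexp (-((1 + c * v) / v / 2) * y ^ 2))
      (c * m * v / (1 + c * v)),
    integral_gaussian ((1 + c * v) / v / 2)]
  have h1 : π / ((1 + c * v) / v / 2) = (2 * π * v) / (1 + c * v) := by
    field_simp
  rw [h1, Real.sqrt_div' _ hApos.le]
  have h2 : √(2 * π * v) ≠ 0 := (Real.sqrt_pos.2 (by positivity)).ne'
  have h3 : √(1 + c * v) ≠ 0 := (Real.sqrt_pos.2 hApos).ne'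
  field_simp

/-- Special case `m = 0`: `∫ exp(-c x²/2) 𝒩(0,v)(dx) = 1/√(1 + c v)` for `c ≥ 0`. [folklore] -/
theorem integral_exp_neg_mul_sq_gaussianReal (v : ℝ≥0) {c : ℝ} (hc : 0 ≤ c) :
    ∫ x, rexp (-(c * x ^ 2) / 2) ∂gaussianReal 0 v = 1 / √(1 + c * v) := by
  have h := integral_exp_neg_mul_add_sq_gaussianReal v hc 0
  simpa using h

variable {Ω : Type*} [MeasurableSpace Ω] {P : Measure Ω}

/-- The covariance of a pair vanishes when the first variable is a.e. constant (here: centred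
with variance zero). [folklore] -/
theorem covariance_eq_zero_of_variance_eq_zero [IsProbabilityMeasure P] {X Y : Ω → ℝ}
    (hX : MemLp X 2 P) (hvar : Var[X; P] = 0) : cov[X, Y; P] = 0 := by
  have hae := ae_eq_integral_of_variance_eq_zero hX hvar
  unfold covariance
  refine integral_eq_zero_of_ae ?_
  filter_upwards [hae] with ω hω
  simp [hω]

/-- **Expectation of `exp(-(kX² + lY²)/2)` for a centred jointly Gaussian pair** with
`Var X = a`, `Var Y = b`, `Cov(X,Y) = c` and `k, l ≥ 0`:
`E exp(-(k X² + l Y²)/2) = 1/√((1 + k a)(1 + l b) - k l c²)` (`= det(I + ΣD)^{-1/2}`).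
Proof by decorrelation: `W = Y - (c/a) X` is Gaussian, uncorrelated with hence independent of
`X` (Mathlib's `HasGaussianLaw.indepFun_of_covariance_eq_zero`), and the two resulting
one-dimensional integrals are `integral_exp_neg_mul_add_sq_gaussianReal`. [folklore] -/
theorem integral_exp_neg_quadratic_of_hasGaussianLaw [IsProbabilityMeasure P] {X Y : Ω → ℝ}
    (hXY : HasGaussianLaw (fun ω ↦ (X ω, Y ω)) P) (hX0 : P[X] = 0) (hY0 : P[Y] = 0)
    {a b c : ℝ} (ha : Var[X; P] = a) (hb : Var[Y; P] = b) (hc : cov[X, Y; P] = c)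
    {k l : ℝ} (hk : 0 ≤ k) (hl : 0 ≤ l) :
    ∫ ω, rexp (-(k * X ω ^ 2 + l * Y ω ^ 2) / 2) ∂P =
      1 / √((1 + k * a) * (1 + l * b) - k * l * c ^ 2) := by
  have hXg : HasGaussianLaw X P := hXY.fst
  have hYg : HasGaussianLaw Y P := hXY.snd
  have hXm : MemLp X 2 P := hXg.memLp_two
  have hYm : MemLp Y 2 P := hYg.memLp_two
  have ha0 : 0 ≤ a := ha ▸ variance_nonneg X P
  -- the regression coefficient (Lean's `c / 0 = 0` handles the degenerate case `a = 0`)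
  set α : ℝ := c / a with hα
  have hc0 : a = 0 → c = 0 := fun h => by
    rw [← hc]
    exact covariance_eq_zero_of_variance_eq_zero hXm (ha.trans h)
  have hαa : α * a = c := by
    by_cases h : a = 0
    · rw [h, mul_zero, hc0 h]
    · rw [hα, div_mul_cancel₀ c h]
  -- the decorrelated variable `W = Y - α X`
  set W : Ω → ℝ := fun ω => Y ω - α * X ω with hW
  have hWm : MemLp W 2 P := hYm.sub (hXm.const_mul α)
  have hXW : HasGaussianLaw (fun ω ↦ (X ω, W ω)) P := by
    have h := hXY.map ((ContinuousLinearMap.fst ℝ ℝ ℝ).prod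
      (ContinuousLinearMap.snd ℝ ℝ ℝ - α • ContinuousLinearMap.fst ℝ ℝ ℝ))
    have hfun : (⇑((ContinuousLinearMap.fst ℝ ℝ ℝ).prod
        (ContinuousLinearMap.snd ℝ ℝ ℝ - α • ContinuousLinearMap.fst ℝ ℝ ℝ)) ∘ fun ω ↦ (X ω, Y ω)) =
        fun ω ↦ (X ω, W ω) := by
      funext ω
      simp [hW]
    rw [hfun] at h
    exact h
  have hWg : HasGaussianLaw W P := hXW.snd
  have hcov : cov[X, W; P] = 0 := by
    rw [hW, covariance_fun_sub_right hXm hYm (hXm.const_mul α), covariance_const_mul_right,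
      covariance_self hXm.aemeasurable, ha, hc, hαa, sub_self]
  have hind : IndepFun X W P := hXW.indepFun_of_covariance_eq_zero hcov
  have hW0 : P[W] = 0 := by
    rw [hW, integral_sub (hYm.integrable (by norm_num)) ((hXm.const_mul α).integrable (by norm_num)),
      integral_const_mul, hX0, hY0]
    simp
  have hWvar : Var[W; P] = b - α * c := by
    rw [hW, variance_fun_sub hYm (hXm.const_mul α), covariance_const_mul_right, covariance_comm,
      hc, hb, variance_const_mul, ha]
    linear_combination α * hαa
  have hbW : 0 ≤ b - α * c := hWvar ▸ variance_nonneg W P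
  -- laws of `X` and `W`
  have hlawX : P.map X = gaussianReal 0 a.toNNReal := by
    rw [hXg.map_eq_gaussianReal, hX0, ha]
  have hlawW : P.map W = gaussianReal 0 (b - α * c).toNNReal := by
    rw [hWg.map_eq_gaussianReal, hW0, hWvar]
  -- the integrand as a function of `(X, W)`
  set F : ℝ × ℝ → ℝ := fun p => rexp (-(k * p.1 ^ 2) / 2) * rexp (-(l * (α * p.1 + p.2) ^ 2) / 2)
    with hF
  have hFcont : Continuous F := by
    rw [hF]
    fun_prop
  have hFbd : ∀ p, ‖F p‖ ≤ 1 := by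
    intro p
    rw [hF]
    dsimp only
    rw [Real.norm_eq_abs, abs_of_nonneg (by positivity)]
    refine mul_le_one₀ ?_ (by positivity) ?_
    · refine Real.exp_le_one_iff.2 ?_
      have : 0 ≤ k * p.1 ^ 2 := by positivity
      linarith
    · refine Real.exp_le_one_iff.2 ?_
      have : 0 ≤ l * (α * p.1 + p.2) ^ 2 := by positivity
      linarith
  have hFeq : ∀ ω, rexp (-(k * X ω ^ 2 + l * Y ω ^ 2) / 2) = F (X ω, W ω) := by
    intro ω
    rw [hF, hW]
    dsimp only
    rw [← Real.exp_add]
    congr 1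
    ring
  simp_rw [hFeq]
  have hXae : AEMeasurable X P := hXg.aemeasurable
  have hWae : AEMeasurable W P := hWg.aemeasurable
  rw [← integral_map (hXae.prodMk hWae) hFcont.aestronglyMeasurable,
    (indepFun_iff_map_prod_eq_prod_map_map hXae hWae).1 hind, hlawX, hlawW]
  have hFint : Integrable F ((gaussianReal 0 a.toNNReal).prod (gaussianReal 0 (b - α * c).toNNReal)) :=
    Integrable.of_bound hFcont.aestronglyMeasurable 1 (ae_of_all _ hFbd)
  rw [integral_prod F hFint]
  -- inner integral
  have hinner : ∀ x : ℝ, ∫ w, F (x, w) ∂gaussianReal 0 (b - α * c).toNNReal =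
      rexp (-(k * x ^ 2) / 2) * (rexp (-(l * (α * x) ^ 2) / (2 * (1 + l * (b - α * c)))) /
        √(1 + l * (b - α * c))) := by
    intro x
    rw [hF]
    dsimp only
    rw [integral_const_mul, integral_exp_neg_mul_add_sq_gaussianReal _ hl (α * x),
      Real.coe_toNNReal _ hbW]
  simp_rw [hinner]
  have hB : 0 < 1 + l * (b - α * c) := by positivity
  -- outer integral: collect the Gaussian factor
  have hk' : 0 ≤ k + l * α ^ 2 / (1 + l * (b - α * c)) := by positivity
  have houter : ∀ x : ℝ, rexp (-(k * x ^ 2) / 2) *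
      (rexp (-(l * (α * x) ^ 2) / (2 * (1 + l * (b - α * c)))) / √(1 + l * (b - α * c))) =
      (√(1 + l * (b - α * c)))⁻¹ * rexp (-((k + l * α ^ 2 / (1 + l * (b - α * c))) * x ^ 2) / 2) := by
    intro x
    rw [mul_div_assoc', ← Real.exp_add, div_eq_inv_mul]
    congr 2
    field_simp
    ring
  simp_rw [houter]
  rw [integral_const_mul, integral_exp_neg_mul_sq_gaussianReal _ hk', Real.coe_toNNReal _ ha0]
  -- algebra: the product of the two factors is the determinant
  have hdet : (1 + l * (b - α * c)) * (1 + (k + l * α ^ 2 / (1 + l * (b - α * c))) * a) =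
      (1 + k * a) * (1 + l * b) - k * l * c ^ 2 := by
    have h1 : (1 + l * (b - α * c)) * (1 + (k + l * α ^ 2 / (1 + l * (b - α * c))) * a) =
        (1 + l * (b - α * c)) * (1 + k * a) + l * α ^ 2 * a := by
      field_simp
      ring
    rw [h1]
    linear_combination (l * α - k * l * c) * hαa
  rw [← hdet, Real.sqrt_mul hB.le]
  ring

end Literature.Probability.Distributions
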